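import Literature.Probability.Percolation.Z2PivotalCampbellLimit
import Summits.CriticalPhenomena.CardyFormulaZ2.Theorems.CardyMeckeFlipFlipErgodicityZ2StubLatticeCampbellKernel

/-!
# Crux `FlipErgodicityZ2` (stmt-CriticalPhenomena-14825), line `registered`: stub `stub_patternCampbellLimit`

Route `Summits/CriticalPhenomena/CardyFormulaZ2/Theses/CardyMeckeFlip`.  **The pattern Campbell
functionals pass to the limit** (stub 2b-L of the reshaped birth skeleton, the glue node of the
limit passage of the lattice Campbell–Mecke identity): along a mesh sequence `δ_k → 0⁺` realising
a subsequential quad-crossing limit `μ` of bond-`ℤ²` percolation and along which the pair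
(configuration `ω_{δ_k} ∈ ℋ`, Garban–Pete–Schramm measure `μ^ε_{δ_k}(ω)`) converges jointly in law
to `(S, M ε S)`, for every `φ ∈ C_c(ℂ)` with `sup_k E[⟨μ^ε_{δ_k}, |φ|⟩²] < ∞` and every cylinder
datum `(Q, g)`,

  `E[ ∫ φ(z) g({i | Qᵢ ∈ ω_{δ_k}}) μ^ε_{δ_k}(ω)(dz) ] → ∫ ∫ φ(x) g({i | Qᵢ ∈ S}) (M ε S)(dx) dμ(S)`.

Proof.  (a) `g(pattern)` does not depend on the integration variable, so both inner integrals
are `⟨·, φ⟩ · g(pattern)`.  (b) Split `φ = φ⁺ - φ⁻`; on the lattice `⟨μ^ε_δ, φ⟩ = ⟨μ^ε_δ, φ⁺⟩ -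
⟨μ^ε_δ, φ⁻⟩` exactly (local finiteness), and on the limit side the same linearity holds
`μ`-almost surely — it is inherited from the lattice through the joint convergence tested on the
bounded continuous `min 1 |v₀ - v₁ + v₂|` (`ae_eq_sub_of_tendsto_triple`).  (c) For `φ^± ≥ 0`
the limit passage is `tendsto_integral_integral_mul_apply_pattern_of_nonneg` of the Literature
file `Z2PivotalCampbellLimit.lean`: decompose `g(pattern) = Σ_T g(T) 1{pattern = T}` over the
finitely many patterns; each atom `{S | {i | Qᵢ ∈ S} = T}` is Borel and a `μ`-continuity set
(Schramm–Smirnov 2011 Lemma 5.1, proved in the tree), and the model-free glue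
`tendsto_integral_mul_indicator_of_tendsto_pair` (portmanteau sandwich for the truncated weights +
uniform second moments, which for `φ^±` are dominated by those of `|φ|`) applies atom by atom.
-/

noncomputable section

open MeasureTheory Set Filter Metric Topology
open Literature.Probability.Percolation Literature.Probability.Percolation.QuadCrossing
open Literature.Probability.LatticeModels Literature.Probability.Distributions
open scoped ENNReal Topology BoundedContinuousFunction

namespace Summit.CriticalPhenomena.CardyFormulaZ2.Theorems.CardyMeckeFlip

/-! ### The registered stub -/

/-- **Stub 2b-L of the birth skeleton of crux `FlipErgodicityZ2` — the pattern Campbell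
functionals pass to the limit**, verbatim the registered signature: along a mesh sequence
`δ_k → 0⁺` realising `μ` and along which `(ω_δ, μ^ε_δ(ω))` converges jointly in law to
`(S, M ε S)` (the convergence clause of `IsZ2PivotalKernelLimit`), for every `φ ∈ C_c(ℂ)` with
`sup_k E[⟨μ^ε_{δ_k}, |φ|⟩²] < ∞` and every cylinder datum `(Q, g)`,
`E[∫ φ g({i | Qᵢ ∈ ω_{δ_k}}) dμ^ε_{δ_k}(ω)] → ∫ ∫ φ g({i | Qᵢ ∈ S}) d(M ε S) dμ(S)`.
Proof: split `φ = φ⁺ - φ⁻` (linearity is exact on the lattice and almost sure in the limit,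
`ae_eq_sub_of_tendsto_triple`), and apply
`tendsto_integral_integral_mul_apply_pattern_of_nonneg` to `φ⁺` and `φ⁻`, whose second moments
are dominated by those of `|φ|`. [folklore] -/
theorem stub_patternCampbellLimit :
    ∀ (μ : FiniteMeasure (QuadConfig (Set.univ : Set ℂ)))
      (M : ℝ → QuadConfig (Set.univ : Set ℂ) → Measure ℂ) (δs : ℕ → ℝ),
      (∀ k, 0 < δs k) → Tendsto δs atTop (𝓝 0) →
        Tendsto (fun k => z2QuadLaw (Set.univ : Set ℂ) (δs k)) atTop (𝓝 μ) →
          ∀ ε : ℝ, 0 < ε → Measurable (M ε) →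
            (∀ (m : ℕ) (φ : Fin m → ℂ → ℝ), (∀ j, Continuous (φ j)) →
              (∀ j, HasCompactSupport (φ j)) →
                ∀ F : BoundedContinuousFunction (QuadConfig (Set.univ : Set ℂ) × (Fin m → ℝ)) ℝ,
                  Tendsto
                    (fun k => ∫ ω, F (z2QuadConfig (Set.univ : Set ℂ) (δs k) ω,
                        fun j => ∫ x, φ j x ∂(z2PivotalMeasure ε (δs k) ω))
                      ∂(bondPercolation (zdGraph 2) half))
                    atTop
                    (𝓝 (∫ S, F (S, fun j => ∫ x, φ j x ∂(M ε S))
                      ∂(μ : Measure (QuadConfig (Set.univ : Set ℂ)))))) →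
            ∀ φ : ℂ → ℝ, Continuous φ → HasCompactSupport φ →
              (∃ C : ℝ, ∀ k, ∫ ω, (∫ x, |φ x| ∂(z2PivotalMeasure ε (δs k) ω)) ^ 2
                  ∂(bondPercolation (zdGraph 2) half) ≤ C) →
                ∀ (n : ℕ) (Q : Fin n → Quad (Set.univ : Set ℂ)) (g : Set (Fin n) → ℝ),
                  Tendsto
                    (fun k => ∫ ω, ∫ z, φ z * g {i | Q i ∈ z2QuadConfig (Set.univ : Set ℂ) (δs k) ω}
                      ∂(z2PivotalMeasure ε (δs k) ω) ∂(bondPercolation (zdGraph 2) half))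
                    atTop
                    (𝓝 (∫ S, ∫ x, φ x * g {i | Q i ∈ S} ∂(M ε S)
                      ∂(μ : Measure (QuadConfig (Set.univ : Set ℂ))))) := by
  intro μ M δs hpos h0 hlaw ε hε hM hjoint φ hφ hφc hC n Q g
  obtain ⟨C, hC⟩ := hC
  have hμΛ : IsSubseqQuadLimit univ μ := (isSubseqQuadLimit_iff univ μ).2 ⟨δs, hpos, h0, hlaw⟩
  -- positive and negative parts of `φ`
  set ψ₁ : ℂ → ℝ := fun x => max (φ x) 0 with hψ₁
  set ψ₂ : ℂ → ℝ := fun x => max (-φ x) 0 with hψ₂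
  have hψ₁c : Continuous ψ₁ := hφ.max continuous_const
  have hψ₂c : Continuous ψ₂ := hφ.neg.max continuous_const
  have hψ₁s : HasCompactSupport ψ₁ := hφc.comp_left (g := fun a : ℝ => max a 0) (max_self 0)
  have hψ₂s : HasCompactSupport ψ₂ :=
    hφc.comp_left (g := fun a : ℝ => max (-a) 0) (by simp only [neg_zero, max_self])
  have hψ₁0 : ∀ x, 0 ≤ ψ₁ x := fun x => le_max_right _ _
  have hψ₂0 : ∀ x, 0 ≤ ψ₂ x := fun x => le_max_right _ _
  have hψ₁le : ∀ x, ψ₁ x ≤ |φ x| := fun x => max_le (le_abs_self _) (abs_nonneg _)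
  have hψ₂le : ∀ x, ψ₂ x ≤ |φ x| := fun x => max_le (neg_le_abs _) (abs_nonneg _)
  have hφeq : ∀ x, φ x = ψ₁ x - ψ₂ x := fun x => (max_zero_sub_max_neg_zero_eq_self (φ x)).symm
  have hφa : Continuous fun x => |φ x| := hφ.abs
  have hφas : HasCompactSupport fun x => |φ x| := hφc.abs
  -- second moments of `φ^±` are dominated by those of `|φ|`
  have hmom : ∀ {ψ : ℂ → ℝ}, Continuous ψ → HasCompactSupport ψ → (∀ x, 0 ≤ ψ x) →
      (∀ x, ψ x ≤ |φ x|) → ∀ k, ∫ ω, (∫ x, ψ x ∂(z2PivotalMeasure ε (δs k) ω)) ^ 2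
        ∂(bondPercolation (zdGraph 2) half) ≤ C := by
    intro ψ hψ hψs hψ0 hψle k
    refine le_trans (integral_mono (integrable_sq_integral_z2PivotalMeasure hε (hpos k) hψ hψs)
      (integrable_sq_integral_z2PivotalMeasure hε (hpos k) hφa hφas) fun ω => ?_) (hC k)
    haveI := isFiniteMeasureOnCompacts_z2PivotalMeasure ε (hpos k) ω
    exact pow_le_pow_left₀ (integral_nonneg hψ0) (integral_mono
      (hψ.integrable_of_hasCompactSupport hψs) (hφa.integrable_of_hasCompactSupport hφas) hψle) 2
  -- joint convergence for a single test function
  have hconv : ∀ {ψ : ℂ → ℝ}, Continuous ψ → HasCompactSupport ψ →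
      ∀ F : BoundedContinuousFunction (QuadConfig (univ : Set ℂ) × ℝ) ℝ,
        Tendsto (fun k => ∫ ω, F (z2QuadConfig (univ : Set ℂ) (δs k) ω,
            ∫ x, ψ x ∂(z2PivotalMeasure ε (δs k) ω)) ∂(bondPercolation (zdGraph 2) half))
          atTop (𝓝 (∫ S, F (S, ∫ x, ψ x ∂(M ε S)) ∂(μ : Measure (QuadConfig (univ : Set ℂ))))) :=
    fun hψ hψs => tendsto_pair_of_tendsto_fin_one
      (hjoint 1 (fun _ => _) (fun _ => hψ) (fun _ => hψs))
  -- the limit passage for `φ⁺` and `φ⁻`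
  obtain ⟨h₁, hI₁⟩ := tendsto_integral_integral_mul_apply_pattern_of_nonneg μ M δs hpos hμΛ hε hM
    hψ₁c hψ₁s hψ₁0 (hconv hψ₁c hψ₁s) (hmom hψ₁c hψ₁s hψ₁0 hψ₁le) Q g
  obtain ⟨h₂, hI₂⟩ := tendsto_integral_integral_mul_apply_pattern_of_nonneg μ M δs hpos hμΛ hε hM
    hψ₂c hψ₂s hψ₂0 (hconv hψ₂c hψ₂s) (hmom hψ₂c hψ₂s hψ₂0 hψ₂le) Q g
  -- linearity: exact on the lattice ...
  have hlat : ∀ k ω, ∫ x, φ x ∂(z2PivotalMeasure ε (δs k) ω) =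
      ∫ x, ψ₁ x ∂(z2PivotalMeasure ε (δs k) ω) - ∫ x, ψ₂ x ∂(z2PivotalMeasure ε (δs k) ω) := by
    intro k ω
    haveI := isFiniteMeasureOnCompacts_z2PivotalMeasure ε (hpos k) ω
    rw [← integral_sub (hψ₁c.integrable_of_hasCompactSupport hψ₁s)
      (hψ₂c.integrable_of_hasCompactSupport hψ₂s)]
    exact integral_congr_ae (ae_of_all _ fun x => hφeq x)
  -- ... and almost sure in the limit
  have hae : ∀ᵐ S ∂(μ : Measure (QuadConfig (univ : Set ℂ))),
      ∫ x, φ x ∂(M ε S) = ∫ x, ψ₁ x ∂(M ε S) - ∫ x, ψ₂ x ∂(M ε S) := by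
    have h3c : ∀ j, Continuous (![φ, ψ₁, ψ₂] j) := fun j => by
      fin_cases j
      · exact hφ
      · exact hψ₁c
      · exact hψ₂c
    have h3s : ∀ j, HasCompactSupport (![φ, ψ₁, ψ₂] j) := fun j => by
      fin_cases j
      · exact hφc
      · exact hψ₁s
      · exact hψ₂s
    have h := ae_eq_sub_of_tendsto_triple
      (X := fun k => z2QuadConfig (univ : Set ℂ) (δs k))
      (v := fun k ω j => ∫ x, (![φ, ψ₁, ψ₂] j) x ∂(z2PivotalMeasure ε (δs k) ω))
      (w := fun S j => ∫ x, (![φ, ψ₁, ψ₂] j) x ∂(M ε S))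
      (hjoint 3 ![φ, ψ₁, ψ₂] h3c h3s) (fun k ω => hlat k ω)
      (fun j => measurable_integral_of_measurable_measure hM (h3c j).stronglyMeasurable)
    exact h
  -- integrability of the Campbell integrands
  have hGm : ∀ k, Measurable fun ω : BondConfig (Site 2) =>
      g {i | Q i ∈ z2QuadConfig (univ : Set ℂ) (δs k) ω} := fun k =>
    measurable_comp_crossingPattern Q g (hpos k)
  have hGb : ∀ A : Set (Fin n), |g A| ≤ ∑ B : Set (Fin n), |g B| := fun A => abs_apply_le_sum_abs g A
  have hGm' : Measurable fun S : QuadConfig (univ : Set ℂ) => g {i | Q i ∈ S} :=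
    measurable_apply_pattern Q g
  have hlhs : ∀ k,
      ∫ ω, (∫ x, ψ₁ x ∂(z2PivotalMeasure ε (δs k) ω)) *
          g {i | Q i ∈ z2QuadConfig (univ : Set ℂ) (δs k) ω} ∂(bondPercolation (zdGraph 2) half) -
        ∫ ω, (∫ x, ψ₂ x ∂(z2PivotalMeasure ε (δs k) ω)) *
          g {i | Q i ∈ z2QuadConfig (univ : Set ℂ) (δs k) ω} ∂(bondPercolation (zdGraph 2) half) =
      ∫ ω, (∫ x, φ x ∂(z2PivotalMeasure ε (δs k) ω)) *
          g {i | Q i ∈ z2QuadConfig (univ : Set ℂ) (δs k) ω} ∂(bondPercolation (zdGraph 2) half) := by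
    intro k
    rw [← integral_sub (integrable_integral_z2PivotalMeasure_mul hε (hpos k) hψ₁c hψ₁s (hGm k)
      (fun ω => hGb _)) (integrable_integral_z2PivotalMeasure_mul hε (hpos k) hψ₂c hψ₂s (hGm k)
      (fun ω => hGb _))]
    refine integral_congr_ae (ae_of_all _ fun ω => ?_)
    simp only
    rw [← sub_mul, ← hlat k ω]
  have hrhs :
      ∫ S, (∫ x, ψ₁ x ∂(M ε S)) * g {i | Q i ∈ S} ∂(μ : Measure (QuadConfig (univ : Set ℂ))) -
        ∫ S, (∫ x, ψ₂ x ∂(M ε S)) * g {i | Q i ∈ S} ∂(μ : Measure (QuadConfig (univ : Set ℂ))) =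
      ∫ S, (∫ x, φ x ∂(M ε S)) * g {i | Q i ∈ S} ∂(μ : Measure (QuadConfig (univ : Set ℂ))) := by
    rw [← integral_sub
      (hI₁.mul_bdd hGm'.aestronglyMeasurable
        (ae_of_all _ fun S => (Real.norm_eq_abs _).le.trans (hGb _)))
      (hI₂.mul_bdd hGm'.aestronglyMeasurable
        (ae_of_all _ fun S => (Real.norm_eq_abs _).le.trans (hGb _)))]
    refine integral_congr_ae ?_
    filter_upwards [hae] with S hS
    rw [← sub_mul, ← hS]
  have key : Tendsto (fun k => ∫ ω, (∫ x, φ x ∂(z2PivotalMeasure ε (δs k) ω)) *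
      g {i | Q i ∈ z2QuadConfig (univ : Set ℂ) (δs k) ω} ∂(bondPercolation (zdGraph 2) half))
      atTop (𝓝 (∫ S, (∫ x, φ x ∂(M ε S)) * g {i | Q i ∈ S}
        ∂(μ : Measure (QuadConfig (univ : Set ℂ))))) := by
    rw [← hrhs]
    exact (h₁.sub h₂).congr hlhs
  simp_rw [integral_mul_const]
  exact key

end Summit.CriticalPhenomena.CardyFormulaZ2.Theorems.CardyMeckeFlip

end
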